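import Mathlib
import HarnessLib
import Literature.Computability.AlgebraicComplexity.PatternExpressions
import Summits.ValiantsHypothesis.ValiantsHypothesis.Theorems.MonotoneRestorationOrbitCompressionQPTwoPinnedEntriesRow

/-!
# Route MonotoneRestoration — aside `OrbitCompressionQP` (stmt-ValiantsHypothesis-18332), line
# `expression_compression`: 2-row strata from PRODUCTS OF PINNED GADGETS (column-local, separately symmetric)

With the pinned-entry row gadgets (`…PinnedEntryRow`, `…TwoPinnedEntriesRow`) both rows of a 2-row family
can carry a symmetric dependence.  For `VQP` families `U_n(t; s)`, `H_n(t; r)` (resp. `U_n(t,t'; s)`,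
`H_n(t,t'; r)`) symmetric in the row variables, the inner polynomials

  `g_n(r, s) = Σ_b U_n(s_b; s) · H_n(r_b; r)`   resp.   `g_n(r, s) = Σ_{b,b'} U_n(s_b, s_{b'}; s) · H_n(r_b, r_{b'}; r)`

are column-symmetric, of arbitrary degree in BOTH rows, and not column-separable; they contain the
second-row-affine (`U = t`) and the diagonal second-row-quadratic (`U = t²`) inner polynomials.  Their 2-row
families are NQP, with ONE row label used twice (the two row sums are independent):

* ★ `narrowQP_twoRow_pinnedProduct` — `f_n = Σ_b (Σ_{i'} U_n(x_{i'b}; row i')) · (Σ_i H_n(x_{ib}; row i))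
  = Σ_{i,i'} g_n(row i, row i')` satisfies the conclusion of `stub_narrowExpressionCompression` (`(1,1)` labels);
* ★ `narrowQP_twoRow_twoPinnedProduct` — the two-pinned version (`(1,2)` labels).

What remains of the 2-row stratum after these: inner polynomials whose column-local factor
`Φ_n(t, t'; r, s)` is JOINTLY but not separately generated — symmetric cores for the Young subgroup
`S_n × S_n` (Bläser–Jindal for two blocks, not in the tree) — and second-row degree growing with `n`.

Helper file (`--supports stmt-ValiantsHypothesis-18332`); def-free; nothing here is a named fact; no registered
stub is closed; VP ≠ VNP is not moved.
-/

noncomputable section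

open MvPolynomial

-- `Summit.ValiantsHypothesis.ValiantsHypothesis.…` is the tree's single-conjunct layout (Sub = Summit).
set_option linter.dupNamespace false

namespace Summit.ValiantsHypothesis.ValiantsHypothesis.Theorems

namespace FormulaSubstitution

open Literature.Computability.AlgebraicComplexity

/-- ★ **2-row stratum from a product of pinned-entry gadgets.**  For `VQP` families `U_n, H_n ∈ ℂ[t, r]`
symmetric in `r`, the matrix-symmetric family
`f_n = Σ_b (Σ_{i'} U_n(x_{i'b}; row i')) · (Σ_i H_n(x_{ib}; row i)) = Σ_{i,i'} Σ_b U_n(x_{i'b}; row i') H_n(x_{ib}; row i)`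
satisfies the conclusion of `stub_narrowExpressionCompression` (with `(1,1)` labels).
[cite: BlaserJindal2019, Thm. 4] -/
theorem narrowQP_twoRow_pinnedProduct (U H : (n : ℕ) → MvPolynomial (Option (Fin n)) ℂ)
    (hUs : ∀ (n : ℕ) (τ : Equiv.Perm (Fin n)), rename (Option.map τ) (U n) = U n)
    (hHs : ∀ (n : ℕ) (τ : Equiv.Perm (Fin n)), rename (Option.map τ) (H n) = H n)
    (hU : IsVQPFamily U) (hH : IsVQPFamily H) :
    ∃ c : ℕ, ∀ n : ℕ, 1 ≤ n → ∃ (k l : ℕ) (e : PatternExpr ℂ k l),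
      n ^ (k + l) ≤ 2 ^ ((Nat.log 2 n + c) ^ c) ∧ e.length ≤ 2 ^ ((Nat.log 2 n + c) ^ c) ∧
      e.close n = ∑ b : Fin n,
        (∑ i' : Fin n, aeval (fun o : Option (Fin n) => o.elim (X (i', b))
          (fun j => (X (i', j) : MvPolynomial (Fin n × Fin n) ℂ))) (U n)) *
        (∑ i : Fin n, aeval (fun o : Option (Fin n) => o.elim (X (i, b))
          (fun j => (X (i, j) : MvPolynomial (Fin n × Fin n) ℂ))) (H n)) := by
  classical
  obtain ⟨c₁, hc₁⟩ := exists_pinnedEntryRowGadget U hUs hU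
  obtain ⟨c₂, hc₂⟩ := exists_pinnedEntryRowGadget H hHs hH
  obtain ⟨c₃, hc₃⟩ := NarrowClosure.qp_combine c₁ c₂
  refine ⟨max c₃ 3, fun n hn => ?_⟩
  obtain ⟨WU, hWUl, hWUv⟩ := hc₁ n hn
  obtain ⟨WH, hWHl, hWHv⟩ := hc₂ n hn
  set GU : Fin n → Fin n → MvPolynomial (Fin n × Fin n) ℂ := fun i b =>
    aeval (fun o : Option (Fin n) => o.elim (X (i, b))
      (fun j => (X (i, j) : MvPolynomial (Fin n × Fin n) ℂ))) (U n) with hGU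
  set GH : Fin n → Fin n → MvPolynomial (Fin n × Fin n) ℂ := fun i b =>
    aeval (fun o : Option (Fin n) => o.elim (X (i, b))
      (fun j => (X (i, j) : MvPolynomial (Fin n × Fin n) ℂ))) (H n) with hGH
  have hWU : ∀ (ρ γ : Fin 1 → Fin n), WU.value n ρ γ = GU (ρ 0) (γ 0) := fun ρ γ => hWUv ρ γ
  have hWH : ∀ (ρ γ : Fin 1 → Fin n), WH.value n ρ γ = GH (ρ 0) (γ 0) := fun ρ γ => hWHv ρ γ
  set e₁ : PatternExpr ℂ 1 1 := PatternExpr.sumCol 0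
    (PatternExpr.mul (PatternExpr.sumRow 0 WU) (PatternExpr.sumRow 0 WH)) with he₁
  have hv₁ : ∀ (ρ γ : Fin 1 → Fin n), e₁.value n ρ γ =
      ∑ b : Fin n, (∑ i' : Fin n, GU i' b) * (∑ i : Fin n, GH i b) := by
    intro ρ γ
    simp only [he₁, PatternExpr.value_sumCol, PatternExpr.value_mul, PatternExpr.value_sumRow, hWU, hWH,
      Function.update_self]
  obtain ⟨e₂, hl₂, hc₂'⟩ := exists_close_eq_of_value_const hn e₁ _ hv₁
  refine ⟨1, 1, e₂, ?_, ?_, by rw [hc₂']⟩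
  · calc n ^ (1 + 1) ≤ n ^ 2 + 2 := by norm_num
      _ ≤ 2 ^ ((Nat.log 2 n + 3) ^ 3) := CompressionFloors.pbounded_le_qp n 2
      _ ≤ 2 ^ ((Nat.log 2 n + max c₃ 3) ^ max c₃ 3) :=
          Nat.pow_le_pow_right (by norm_num) (CompressionFloors.polylog_mono (le_max_right _ _))
  · have h := hc₃ (Nat.log 2 n) WU.length WH.length hWUl hWHl
    have hpU := PatternExpr.length_pos WU
    have hpH := PatternExpr.length_pos WH
    calc e₂.length = WU.length + WH.length + 6 := by
          rw [hl₂, he₁]; simp [PatternExpr.length]; ring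
      _ ≤ (WU.length + 2) * (WH.length + 2) := by nlinarith
      _ ≤ 2 ^ ((Nat.log 2 n + c₃) ^ c₃) := h
      _ ≤ 2 ^ ((Nat.log 2 n + max c₃ 3) ^ max c₃ 3) :=
          Nat.pow_le_pow_right (by norm_num) (CompressionFloors.polylog_mono (le_max_left _ _))

/-- ★ **2-row stratum from a product of two-pinned-entries gadgets.**  For `VQP` families
`U_n, H_n ∈ ℂ[t, t', r]` symmetric in `r`, the matrix-symmetric family
`f_n = Σ_{b,b'} (Σ_{i'} U_n(x_{i'b}, x_{i'b'}; row i')) · (Σ_i H_n(x_{ib}, x_{ib'}; row i))`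
`= Σ_{i,i'} Σ_{b,b'} U_n(x_{i'b}, x_{i'b'}; row i') H_n(x_{ib}, x_{ib'}; row i)` satisfies the conclusion of
`stub_narrowExpressionCompression` (with `(1,2)` labels). [cite: BlaserJindal2019, Thm. 4] -/
theorem narrowQP_twoRow_twoPinnedProduct (U H : (n : ℕ) → MvPolynomial (Option (Option (Fin n))) ℂ)
    (hUs : ∀ (n : ℕ) (τ : Equiv.Perm (Fin n)), rename (Option.map (Option.map τ)) (U n) = U n)
    (hHs : ∀ (n : ℕ) (τ : Equiv.Perm (Fin n)), rename (Option.map (Option.map τ)) (H n) = H n)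
    (hU : IsVQPFamily U) (hH : IsVQPFamily H) :
    ∃ c : ℕ, ∀ n : ℕ, 1 ≤ n → ∃ (k l : ℕ) (e : PatternExpr ℂ k l),
      n ^ (k + l) ≤ 2 ^ ((Nat.log 2 n + c) ^ c) ∧ e.length ≤ 2 ^ ((Nat.log 2 n + c) ^ c) ∧
      e.close n = ∑ b : Fin n, ∑ b' : Fin n,
        (∑ i' : Fin n, aeval (fun o : Option (Option (Fin n)) => o.elim (X (i', b))
          (fun o' => o'.elim (X (i', b'))
            (fun j => (X (i', j) : MvPolynomial (Fin n × Fin n) ℂ)))) (U n)) *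
        (∑ i : Fin n, aeval (fun o : Option (Option (Fin n)) => o.elim (X (i, b))
          (fun o' => o'.elim (X (i, b'))
            (fun j => (X (i, j) : MvPolynomial (Fin n × Fin n) ℂ)))) (H n)) := by
  classical
  obtain ⟨c₁, hc₁⟩ := exists_twoPinnedEntriesRowGadget U hUs hU
  obtain ⟨c₂, hc₂⟩ := exists_twoPinnedEntriesRowGadget H hHs hH
  obtain ⟨c₃, hc₃⟩ := NarrowClosure.qp_combine c₁ c₂
  refine ⟨max c₃ 4, fun n hn => ?_⟩
  obtain ⟨WU, hWUl, hWUv⟩ := hc₁ n hn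
  obtain ⟨WH, hWHl, hWHv⟩ := hc₂ n hn
  set GU : Fin n → Fin n → Fin n → MvPolynomial (Fin n × Fin n) ℂ := fun i b b' =>
    aeval (fun o : Option (Option (Fin n)) => o.elim (X (i, b))
      (fun o' => o'.elim (X (i, b'))
        (fun j => (X (i, j) : MvPolynomial (Fin n × Fin n) ℂ)))) (U n) with hGU
  set GH : Fin n → Fin n → Fin n → MvPolynomial (Fin n × Fin n) ℂ := fun i b b' =>
    aeval (fun o : Option (Option (Fin n)) => o.elim (X (i, b))
      (fun o' => o'.elim (X (i, b'))
        (fun j => (X (i, j) : MvPolynomial (Fin n × Fin n) ℂ)))) (H n) with hGH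
  have hWU : ∀ (ρ : Fin 1 → Fin n) (γ : Fin 2 → Fin n), WU.value n ρ γ = GU (ρ 0) (γ 0) (γ 1) :=
    fun ρ γ => hWUv ρ γ
  have hWH : ∀ (ρ : Fin 1 → Fin n) (γ : Fin 2 → Fin n), WH.value n ρ γ = GH (ρ 0) (γ 0) (γ 1) :=
    fun ρ γ => hWHv ρ γ
  set e₀ : PatternExpr ℂ 1 2 :=
    PatternExpr.mul (PatternExpr.sumRow 0 WU) (PatternExpr.sumRow 0 WH) with he₀
  set e₁ : PatternExpr ℂ 1 2 := PatternExpr.sumCol 0 (PatternExpr.sumCol 1 e₀) with he₁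
  have hv₀ : ∀ (ρ : Fin 1 → Fin n) (γ : Fin 2 → Fin n), e₀.value n ρ γ =
      (∑ i' : Fin n, GU i' (γ 0) (γ 1)) * (∑ i : Fin n, GH i (γ 0) (γ 1)) := by
    intro ρ γ
    simp only [he₀, PatternExpr.value_mul, PatternExpr.value_sumRow, hWU, hWH, Function.update_self]
  have hv₁ : ∀ (ρ : Fin 1 → Fin n) (γ : Fin 2 → Fin n), e₁.value n ρ γ =
      ∑ b : Fin n, ∑ b' : Fin n, (∑ i' : Fin n, GU i' b b') * (∑ i : Fin n, GH i b b') := by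
    intro ρ γ
    simp only [he₁, PatternExpr.value_sumCol, hv₀, Function.update_self]
    refine Finset.sum_congr rfl fun b _ => Finset.sum_congr rfl fun b' _ => ?_
    simp
  obtain ⟨e₂, hl₂, hc₂'⟩ := exists_close_eq_of_value_const_kl hn e₁ _ hv₁
  refine ⟨1, 2, e₂, ?_, ?_, by rw [hc₂']⟩
  · calc n ^ (1 + 2) ≤ n ^ 3 + 3 := by norm_num
      _ ≤ 2 ^ ((Nat.log 2 n + 4) ^ 4) := CompressionFloors.pbounded_le_qp n 3
      _ ≤ 2 ^ ((Nat.log 2 n + max c₃ 4) ^ max c₃ 4) :=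
          Nat.pow_le_pow_right (by norm_num) (CompressionFloors.polylog_mono (le_max_right _ _))
  · have h := hc₃ (Nat.log 2 n) WU.length WH.length hWUl hWHl
    have hpU := PatternExpr.length_pos WU
    have hpH := PatternExpr.length_pos WH
    calc e₂.length = WU.length + WH.length + 7 := by
          rw [hl₂, he₁, he₀]; simp [PatternExpr.length]; ring
      _ ≤ (WU.length + 2) * (WH.length + 2) := by nlinarith
      _ ≤ 2 ^ ((Nat.log 2 n + c₃) ^ c₃) := h
      _ ≤ 2 ^ ((Nat.log 2 n + max c₃ 4) ^ max c₃ 4) :=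
          Nat.pow_le_pow_right (by norm_num) (CompressionFloors.polylog_mono (le_max_left _ _))

end FormulaSubstitution

end Summit.ValiantsHypothesis.ValiantsHypothesis.Theorems

end
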